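import Summits.ResolutionOfSingularities.ResolutionOfSingularities.Theorems.PurelyInseparableDim4AtlasRootShear
import HarnessLib

/-!
# Purely inseparable four-folds: LINEAR CONJUGATES OF CERTIFIED POLYNOMIALS ARE CERTIFIED — the class of `F` with a tranche-1 plan at the
# root host is closed under the (cleaned) linear re-coordinatisations of the root centre variables (brick S3 (c) v4, tranche 1½ corollary;
# cell `res-dim4-pi`)

[OURS · counted 0] (D-0157 DOOR 2; host item stmt-ResolutionOfSingularities-16155, helper). Nothing here proves resolution of
singularities in dimension ≥ 4 / characteristic `p`. Corollary of tranche 1½ (`exists_isMarkedResolution_atlas_root_shear`, p726626;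
finding E-V4-4, memo `res-dim4-typ-3/S3c-V4-ATLAS-MEMBERS-DESIGN.md` §16): if `F̃ ≠ 0` is clean and the hypotheses of tranche 1's root theorem
(`exists_isMarkedResolution_atlas_root`, p720537) hold for `F̃` at the root point `0` with centre `S` — `S` permissible, `BlockA` along `AEdge`
from `(⟨F̃, 0, ∅⟩, S, ∅, ∅)`, accessibility, every closed order-`p` point of `z^p + F̃` on `x_S = 0` — then for EVERY `K`-automorphism `τ` of
`K[x₁..x₄]` with `τ(x_S), τ⁻¹(x_S) ⊆ (x_S)` the CLEANED CONJUGATE `clean(τ⁻¹ F̃)` also has a marked order-`p` reduction: its sheared root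
reading is exactly `F̃`'s root reading (`clean(τ(clean(τ⁻¹ F̃))) = F̃`), and its order-`p` points are carried to those of `F̃` by the automorphism
`Spec Θ` of `𝔸⁵` lifting `τ⁻¹` (G1's `exists_clean_shear_hyp`). So every tranche-1 certificate (A6 p721745, A6b p722563, …) certifies the
whole orbit of its `F` under the (cleaned) linear changes of the root centre variables — e.g. the children at `ξ₁ = c·ξ₀` of §14 (b).

* `deletePthPowers_map_deletePthPowers_symm`, `hypSheaf_conjugate_eq_comap`, **`exists_isMarkedResolution_root_conjugate`**.

AI-produced formalisation, weaker than expert review. bears_on: LADDER-RESOLUTION:D157-DOOR2 (res-dim4-pi · S3 (c) v4 tranche 1½ conjugates).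
-/

set_option linter.dupNamespace false -- D-0017: single-problem summit path `Summit.<S>.<S>.…` by design

noncomputable section

open MvPolynomial Finset CategoryTheory AlgebraicGeometry Opposite TopologicalSpace
open AlgebraicGeometry.Scheme.IdealSheafData (ofIdealTop vanishingIdeal)

namespace Summit.ResolutionOfSingularities.ResolutionOfSingularities.Theorems.PIDim4

open Literature.AlgebraicGeometry.Resolution
open Literature.AlgebraicGeometry.Resolution.Hauser2010
open Literature.AlgebraicGeometry.Resolution.AffinePointBlowup (P A γ coord Wtop ξ)

namespace Equimultiple

section RootConjugate

variable {K : Type} [Field K] {p : ℕ} [hp : Fact p.Prime] [CharP K p] [DecidableEq K]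

omit [DecidableEq K] in
/-- **Shearing back a cleaned conjugate and re-cleaning recovers the clean polynomial**: `clean(τ(clean(τ⁻¹ F))) = F` for `F` clean.
[cite: HauserPerlega2019PRIMS, §2 (cleaning)] -/
theorem deletePthPowers_map_deletePthPowers_symm [PerfectRing K p] (τ : MvPolynomial (Fin 4) K ≃ₐ[K] MvPolynomial (Fin 4) K)
    {F : MvPolynomial (Fin 4) K} (hclean : Literature.Barriers.ResolutionOfSingularities.HauserPerlega.IsClean p F) :
    deletePthPowers p (τ (deletePthPowers p (τ.symm F))) = F := by
  obtain ⟨h, hh⟩ := exists_add_pow_eq_deletePthPowers (p := p) 1 (τ.symm F)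
  rw [pow_one] at hh
  rw [← hh, map_add, map_pow, AlgEquiv.apply_symm_apply, deletePthPowers_add_pow,
    Literature.Barriers.ResolutionOfSingularities.HauserPerlega.deletePthPowers_eq_self hclean]

omit [DecidableEq K] in
/-- **The hypersurface of the cleaned conjugate is the pull-back of the original one along an automorphism of `𝔸⁵` preserving
`V(z, x_S)`**: `(z^p + clean(τ⁻¹ F))·𝒪 = (Spec Θ)^*((z^p + F)·𝒪)` with `Θ xᵢ = τ⁻¹ xᵢ` and `Θ(z, x_S) = (z, x_S)`.
[cite: Hauser2010, §G (coordinate changes and cleaning)] -/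
theorem hypSheaf_conjugate_eq_comap [PerfectRing K p] {S : Finset (Fin 4)} {F : MvPolynomial (Fin 4) K}
    (hclean : Literature.Barriers.ResolutionOfSingularities.HauserPerlega.IsClean p F) (hS : (1 : ℕ∞) ≤ CentreBlowup.ordAlong S F)
    (τ : MvPolynomial (Fin 4) K ≃ₐ[K] MvPolynomial (Fin 4) K)
    (hτ : ∀ i ∈ S, τ (X i) ∈ Ideal.span (X '' (S : Set (Fin 4)) : Set (MvPolynomial (Fin 4) K)))
    (hτ' : ∀ i ∈ S, τ.symm (X i) ∈ Ideal.span (X '' (S : Set (Fin 4)) : Set (MvPolynomial (Fin 4) K))) :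
    ∃ Θ : A 4 K ≃ₐ[K] A 4 K, (∀ i : Fin 4, Θ (X i.succ) = rename Fin.succ (τ.symm (X i))) ∧
      hypSheaf p (deletePthPowers p (τ.symm F)) = (hypSheaf p F).comap (Spec.map (CommRingCat.ofHom (Θ : A 4 K →+* A 4 K))) := by
  have hS' : (1 : ℕ∞) ≤ CentreBlowup.ordAlong S (deletePthPowers p (τ.symm F)) :=
    le_trans (le_ordAlong_map_of_forall_mem_span (τ.symm : MvPolynomial (Fin 4) K →ₐ[K] MvPolynomial (Fin 4) K) hτ' hS)
      (ChartDictionary.ordAlong_le_ordAlong_deletePthPowers p S _)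
  obtain ⟨Θ, g, -, -, hΘs, hhyp, -, -⟩ := exists_clean_shear_hyp (p := p) hS' τ hτ hτ'
  rw [deletePthPowers_map_deletePthPowers_symm τ hclean] at hhyp
  refine ⟨Θ, hΘs, ?_⟩
  rw [hypSheaf, hypSheaf, ChartDictionary.comap_ofIdealTop_span_γ_symm, RingHom.coe_coe, hhyp]

/-- **LINEAR CONJUGATES OF CERTIFIED POLYNOMIALS ARE CERTIFIED.** See the module docstring. [cite: BierstoneGrigorievMilmanWlodarczyk2011,
Def. 3.1.3; Thm. 1.1 (char. 0 model)] [cite: Hauser2010, §§F–G] -/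
theorem exists_isMarkedResolution_root_conjugate [IsAlgClosed K] [DecidableEq (AReading K)] (F : MvPolynomial (Fin 4) K) (hF : F ≠ 0)
    (hclean : Literature.Barriers.ResolutionOfSingularities.HauserPerlega.IsClean p F)
    (plan : AReading K → Finset (Fin 4 × (Fin 4 → K) × Finset (Fin 4)))
    (leaves : AReading K → Finset (Fin 4 × (Fin 4 → K))) (S : Finset (Fin 4)) (hS : IsPermissibleCentre p S F)
    (hblocks : ∀ q : AReading K, Relation.ReflTransGen (fun a e : AReading K => AEdge p plan e a)
      ((⟨F, 0, ∅⟩ : State K), S, (∅ : Finset (Fin 4 × K)), (∅ : Finset (Fin 4))) q → BlockA p plan leaves q)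
    (hacc : Acc (fun q' q : AReading K => AEdge p plan q' q) ((⟨F, 0, ∅⟩ : State K), S, (∅ : Finset (Fin 4 × K)), (∅ : Finset (Fin 4))))
    (hcover : ∀ z : P 4 K, IsClosed ({z} : Set (P 4 K)) → (p : ℕ∞) ≤ idealOrder (hypSheaf p F) z →
      ∀ i ∈ S, (X i.succ : A 4 K) ∈ z.asIdeal)
    (τ : MvPolynomial (Fin 4) K ≃ₐ[K] MvPolynomial (Fin 4) K)
    (hτ : ∀ i ∈ S, τ (X i) ∈ Ideal.span (X '' (S : Set (Fin 4)) : Set (MvPolynomial (Fin 4) K)))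
    (hτ' : ∀ i ∈ S, τ.symm (X i) ∈ Ideal.span (X '' (S : Set (Fin 4)) : Set (MvPolynomial (Fin 4) K))) :
    ∃ (X' : Scheme.{0}) (ρ : X' ⟶ P 4 K) (M' : MarkedIdeal X'),
      IsMarkedResolution (⟨hypSheaf p (deletePthPowers p (τ.symm F)), [], p⟩ : MarkedIdeal (P 4 K)) ρ M' := by
  classical
  haveI : PerfectRing K p := PerfectRing.ofSurjective K p fun x => IsAlgClosed.exists_pow_nat_eq x hp.out.pos
  set G : MvPolynomial (Fin 4) K := deletePthPowers p (τ.symm F) with hG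
  have hGclean : Literature.Barriers.ResolutionOfSingularities.HauserPerlega.IsClean p G := isClean_deletePthPowers _
  have hG0 : G ≠ 0 := deletePthPowers_map_ne_zero_of_isClean τ.symm hF hclean
  have hGt : deletePthPowers p (PointBlowup.translate (0 : Fin 4 → K) G) = G := by
    rw [PointBlowup.translate_zero, hG,
      Literature.Barriers.ResolutionOfSingularities.HauserPerlega.deletePthPowers_eq_self (isClean_deletePthPowers _)]
  have hpermG : IsPermissibleCentre p S (deletePthPowers p (PointBlowup.translate (0 : Fin 4 → K) G)) := by
    rw [hGt]
    refine ⟨hS.1, le_trans ?_ (ChartDictionary.ordAlong_le_ordAlong_deletePthPowers p S _)⟩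
    exact le_ordAlong_map_of_forall_mem_span (τ.symm : MvPolynomial (Fin 4) K →ₐ[K] MvPolynomial (Fin 4) K) hτ' hS.2
  have hsG : ((⟨F, 0, ∅⟩ : State K)) = ⟨deletePthPowers p (τ (deletePthPowers p (PointBlowup.translate (0 : Fin 4 → K) G))), 0, ∅⟩ := by
    rw [hGt, deletePthPowers_map_deletePthPowers_symm τ hclean]
  -- the order-`p` points of the conjugate are carried to those of `F`
  have hS1 : (1 : ℕ∞) ≤ CentreBlowup.ordAlong S F := le_trans (by exact_mod_cast hp.out.one_lt.le) hS.2
  obtain ⟨Θ, hΘs, hcomap⟩ := hypSheaf_conjugate_eq_comap (p := p) hclean hS1 τ hτ hτ'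
  haveI hiso : IsIso (CommRingCat.ofHom (Θ : A 4 K →+* A 4 K)) := (inferInstance : IsIso Θ.toRingEquiv.toCommRingCatIso.hom)
  set gΘ : P 4 K ⟶ P 4 K := Spec.map (CommRingCat.ofHom (Θ : A 4 K →+* A 4 K)) with hgΘ
  haveI : IsIso gΘ := inferInstance
  have hcoverG : ∀ z : P 4 K, IsClosed ({z} : Set (P 4 K)) → (p : ℕ∞) ≤ idealOrder (hypSheaf p G) z →
      ∀ i ∈ S, (X i.succ - C ((0 : Fin 4 → K) i) : A 4 K) ∈ z.asIdeal := by
    intro z hz hord i hi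
    rw [Pi.zero_apply, C_0, sub_zero]
    have hzc : IsClosed ({gΘ z} : Set (P 4 K)) :=
      isClosed_singleton_of_isOpenImmersion_eq (inv gΘ) (gΘ z) hz
        (by rw [← Scheme.Hom.comp_apply, IsIso.hom_inv_id]; rfl)
    have hord' : (p : ℕ∞) ≤ idealOrder (hypSheaf p F) (gΘ z) := by
      rw [← idealOrder_comap_of_isOpenImmersion gΘ (hypSheaf p F) z, ← hcomap]; exact hord
    -- `Θ x_k ∈ 𝔭_z` for `k ∈ S`, and `x_i` lies in the span of the `Θ x_k`
    have hmem : ∀ k ∈ S, Θ (X k.succ) ∈ z.asIdeal := by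
      intro k hk
      have h := hcover (gΘ z) hzc hord' k hk
      rw [hgΘ, Spec.map_apply, PrimeSpectrum.comap_asIdeal, Ideal.mem_comap, CommRingCat.hom_ofHom, RingHom.coe_coe] at h
      exact h
    have hspan : (X i : MvPolynomial (Fin 4) K) ∈
        Ideal.map (τ.symm : MvPolynomial (Fin 4) K →+* MvPolynomial (Fin 4) K) (Ideal.span (X '' (S : Set (Fin 4)))) := by
      have h1 : (X i : MvPolynomial (Fin 4) K) = τ.symm (τ (X i)) := (AlgEquiv.symm_apply_apply τ _).symm
      rw [h1]
      exact Ideal.mem_map_of_mem _ (hτ i hi)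
    rw [Ideal.map_span] at hspan
    have hle : Ideal.map (rename (Fin.succ : Fin 4 → Fin (4 + 1)) : MvPolynomial (Fin 4) K →ₐ[K] A 4 K).toRingHom
        (Ideal.span ((τ.symm : MvPolynomial (Fin 4) K →+* MvPolynomial (Fin 4) K) '' (X '' (S : Set (Fin 4))))) ≤ z.asIdeal := by
      rw [Ideal.map_span, Ideal.span_le]
      rintro _ ⟨_, ⟨_, ⟨k, hk, rfl⟩, rfl⟩, rfl⟩
      show rename Fin.succ ((τ.symm : MvPolynomial (Fin 4) K →+* MvPolynomial (Fin 4) K) (X k)) ∈ z.asIdeal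
      rw [RingHom.coe_coe, ← hΘs k]
      exact hmem k hk
    have h2 := hle (Ideal.mem_map_of_mem _ hspan)
    have h3 : (rename (Fin.succ : Fin 4 → Fin (4 + 1)) : MvPolynomial (Fin 4) K →ₐ[K] A 4 K).toRingHom (X i) = X i.succ := by
      show rename Fin.succ (X i) = X i.succ
      rw [rename_X]
    rw [h3] at h2
    exact h2
  exact exists_isMarkedResolution_atlas_root_shear (p := p) G hG0 hGclean plan leaves 0 S hpermG τ hτ hτ' ⟨F, 0, ∅⟩ hsG
    hblocks hacc hcoverG

end RootConjugate

end Equimultiple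

end Summit.ResolutionOfSingularities.ResolutionOfSingularities.Theorems.PIDim4

end
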